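import Mathlib
import Literature.NumberTheory.Automorphic.BLZPeriodCocycle
import HarnessLib

/-!
# The line model of the principal series of `PSL₂(ℝ)`: action off finite sets, smooth and
smooth semi-analytic vectors, and `1`-cocycles (Bruggeman–Lewis–Zagier §2.1–2.2, §5.1, §9.3)

Bruggeman, Lewis and Zagier, *Period functions for Maass wave forms and cohomology*, Mem. AMS
237 no. 1118 (2015) [BruggemanLewisZagier2015]; page numbers are the PDF pages of the held
authors' version `paper:doi-10-1090-memo-1118`. This file completes the shared vocabulary begun
in `BLZPeriodCocycle` (which has the slash `lineSlash s g` of (2.1), p. 11, the analytic vectors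
`IsAnalyticVector` (2.2) and the semi-analytic vectors `IsSemiAnalyticVector` (2.22), p. 16, with
`V_s^{ω*}` stable under the action) so that routes working with Maass forms of eigenvalue `1/4`
(`s = 1/2`, action `(φ|g)(t) = |ct+d|⁻¹ φ(gt)`) can state period-cocycle conditions without
inlining them.

## What is here

1. **The action off finite sets.** The pole set `{t | ct + d = 0}` of `g ∈ GL₂(ℝ)` is finite
   (`finite_linePole`), so the right-action law `φ|(gh) = (φ|g)|h` of (2.1) holds as an identity
   of functions modulo finite sets (`lineSlash_mul_eventuallyEq`, `=ᶠ[cofinite]`); the slash is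
   `ℂ`-linear in `φ` (`lineSlash_add/sub/zero/smul`); the entries and the `s = 1/2` shape of the
   slash by an integer matrix `γ ∈ SL₂(ℤ)` through Mathlib's `Matrix.SpecialLinearGroup.mapGL ℝ`
   (`lineSlash_mapGL_apply`, `lineSlash_mapGL_one_half` — literally the `slashHalf` of route
   `Langlands/RationalPeriodQuarter`); the flip `flipGL = S = (0 -1; 1 0)` whose slash
   `|t|^{-2s} φ(-1/t)` is the chart at `∞`.
2. **The honest module.** On `LineGerm := Filter.Germ cofinite ℂ` (functions `ℝ → ℂ` modulo
   agreement off a finite set — the line-model reading of sections over `P¹(ℝ) ∖ F`, (2.20)–(2.22))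
   the slash descends to a `ℂ`-linear map `lineSlashGerm s g` and these assemble to a genuine
   representation `principalSeriesLineModel s : Representation ℂ (GL (Fin 2) ℝ)ᵐᵒᵖ LineGerm` of the
   opposite group (BLZ act on the right); `principalSeriesLineModelOf ι s Γ` restricts it to a
   subgroup `Γ ≤ G` along `ι : G →* GL₂(ℝ)` (e.g. `ι = mapGL ℝ`, `Γ = Γ₁(N) ≤ SL₂(ℤ)`), after which
   Mathlib's `groupCohomology.H1 (Rep.of _)` is available.
3. **Smooth and smooth semi-analytic vectors.** `IsSmoothVector s φ` is `V_s^∞` of (2.2), p. 12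
   (`φ ∈ C^∞(ℝ)` with the asymptotic expansion `φ(t) ~ |t|^{-2s} Σ cₙ t⁻ⁿ`, i.e. `φ^P = (1+t²)^s φ`
   is `C^∞` on `P¹(ℝ)`; in the chart at `∞`: `t ↦ |t|^{-2s} φ(-1/t)` extends to a function smooth
   at `0`, the `C^∞` analogue of `IsAnalyticVector`), and `IsSmoothSemiAnalyticVector s φ` is
   `V_s^{ω*,∞} = V_s^{ω*} ∩ V_s^∞` (§9.3, p. 51; (2.23)), the module in which the period functions
   of Maass cusp forms live (Theorem B, p. 6). **Proved**: both are stable under the action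
   ("it requires some work to check that the spaces `V_s^ω, V_s^∞, …` are preserved", p. 12):
   `IsSmoothVector.lineSlash`, `IsSmoothSemiAnalyticVector.lineSlash` — the slash `φ|g` agrees off
   a finite set (namely at the pole, where `lineSlash` has the junk value `0`) with a vector of the
   same kind, the explicit representative being `lineSlashReg` (the removable singularity at the
   pole is filled in through the chart at `∞`: `φ|g = (φ|S)|(Sg)` off the pole).
4. **Cocycles** ((5.4), p. 29, right modules, inhomogeneous): for a group `G`, `ι : G →* GL₂(ℝ)`,
   a subgroup `Γ` and cochains `r : G → (ℝ → ℂ)` read off finite sets,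
   `IsLineCocycle ι s Γ r : r (γδ) ≡ (r γ)|δ + r δ`, the coboundary `lineCoboundary ι s f γ = f|γ - f`
   (a cocycle: `isLineCocycle_lineCoboundary`), `IsLineCohomologous`, and for a coefficient module
   `W : Submodule R (ℝ → ℂ)` (`R = ℚ, ℂ, …`; `semiAnalyticLineVectors`, `smoothLineVectors s`,
   `smoothSemiAnalyticLineVectors s` are provided) the `R`-modules `lineCocycles ι s Γ W = Z¹(Γ; W)`,
   `lineCoboundaries ι s Γ W = B¹(Γ; W)` and `LineH1 ι s Γ W = Z¹/(B¹ ∩ Z¹) = H¹(Γ; W)`; and the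
   check that (5.4) is Mathlib's `groupCohomology.cocycles₁` of `Γᵐᵒᵖ` for the germ representation
   (`isLineCocycle_iff_mem_cocycles₁`).
5. **Germ subrepresentations** `semiAnalyticSubrep s` (`V_s^{ω*}`) and `smoothSemiAnalyticSubrep s`
   (`V_s^{ω*,∞}`) of `principalSeriesLineModel s`, restricted along `ι` to `Γᵐᵒᵖ`
   (`semiAnalyticLineModelOf`, `smoothSemiAnalyticLineModelOf`), so that `H¹(Γ; V_s^{ω*})` and
   `H¹(Γ; V_s^{ω*,∞})` are available as Mathlib `groupCohomology.H1`.

## Conventions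

As in `BLZPeriodCocycle`: total functions `ℝ → ℂ`, identities modulo finite sets; `lineSlash`
is determinant-free and `lineSlash s (-g) = lineSlash s g`, so subgroups of `SL₂` and their
images in `PSL₂` carry the same objects. Values of a cochain `r γ` are required to lie in `W`
literally (for `γ ∈ Γ`), identities between cochains hold off finite sets; hence `B¹(Γ; W)` need
not be contained in `Z¹(Γ; W)` for a `W` that is not closed under modification on finite sets
(e.g. piecewise-rational functions), and `H¹` is `Z¹/(B¹ ∩ Z¹)`.

## What is NOT here

Parabolic / mixed parabolic cohomology `H¹_par(Γ; V, W)`, the modules `V_s^p`, `V_s^{ω*,exc}`,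
`W_s^{ω}` and the (transverse) Poisson transforms, the topology of `V_s^∞`, and the comparison
of the function-level `LineH1` with the Mathlib `H1` of the germ subrepresentations (only the
cocycle-level comparison `isLineCocycle_iff_mem_cocycles₁` is given).

## References

* [BruggemanLewisZagier2015] R. Bruggeman, J. Lewis, D. Zagier, *Period functions for Maass wave
  forms and cohomology*, Mem. Amer. Math. Soc. 237 (2015), no. 1118, doi:10.1090/memo/1118:
  (2.1)–(2.2) pp. 11–12 (line model, `V_s^∞`, `V_s^ω`, "preserved under the action");
  (2.20)–(2.23) pp. 15–16 (`V_s^ω[F]`, `V_s^{ω*}`, `V_s^{ω*,cond}`); (5.4) p. 29 (`Z¹`, `B¹`,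
  `H¹` for right modules); §9.3 p. 51 (`V_s^{ω*,∞} = V_s^{ω*} ∩ V_s^∞`); Theorem B p. 6.
-/

noncomputable section

namespace Literature.NumberTheory.Automorphic

open _root_.Filter _root_.Set
open scoped MatrixGroups Topology ContDiff

/-! ## 1. The action: poles, integer matrices, the flip, linearity -/

section Action

variable (s : ℂ)

/-- The pole set `{t | ct + d = 0}` of `g = (a b; c d) ∈ GL₂(ℝ)` is finite (empty when `c = 0`,
as then `d ≠ 0`; the point `-d/c` otherwise). [folklore] -/
theorem finite_linePole (g : GL (Fin 2) ℝ) : {t : ℝ | g 1 0 * t + g 1 1 = 0}.Finite := by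
  have hdet : (g 0 0 : ℝ) * g 1 1 - g 0 1 * g 1 0 ≠ 0 := by
    have h1 : ((g : GL (Fin 2) ℝ) : Matrix (Fin 2) (Fin 2) ℝ).det ≠ 0 :=
      Matrix.GeneralLinearGroup.det_ne_zero g
    rwa [Matrix.det_fin_two] at h1
  by_cases hc : (g 1 0 : ℝ) = 0
  · have hd : (g 1 1 : ℝ) ≠ 0 := by
      intro hd; apply hdet; rw [hc, hd]; ring
    have : {t : ℝ | g 1 0 * t + g 1 1 = 0} = ∅ := by
      ext t; simp [hc, hd]
    rw [this]; exact finite_empty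
  · refine (finite_singleton (-(g 1 1 : ℝ) / g 1 0)).subset fun t ht => ?_
    simp only [mem_setOf_eq] at ht
    simp only [mem_singleton_iff]
    field_simp
    linarith

/-- Off a finite set, `t` is not the pole of `g`. [folklore] -/
theorem eventually_cofinite_ne_linePole (g : GL (Fin 2) ℝ) :
    ∀ᶠ t in cofinite, (g 1 0 : ℝ) * t + g 1 1 ≠ 0 :=
  Filter.eventually_cofinite.2 (by simpa using finite_linePole g)

/-- **The line model is a right action off finite sets**: `φ |(gh) ≡ (φ | g) | h` modulo the
(finite) pole set of `h` (BLZ (2.1): an identity of sections over `P¹(ℝ)` minus finitely many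
points). [cite: BruggemanLewisZagier2015, (2.1) p. 11] -/
theorem lineSlash_mul_eventuallyEq (g h : GL (Fin 2) ℝ) (φ : ℝ → ℂ) :
    lineSlash s (g * h) φ =ᶠ[cofinite] lineSlash s h (lineSlash s g φ) :=
  (eventually_cofinite_ne_linePole h).mono fun _ ht => lineSlash_mul s g h φ ht

/-- The slash is additive in `φ`. [cite: BruggemanLewisZagier2015, (2.1) p. 11] -/
theorem lineSlash_add (g : GL (Fin 2) ℝ) (φ ψ : ℝ → ℂ) :
    lineSlash s g (φ + ψ) = lineSlash s g φ + lineSlash s g ψ := by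
  funext t; simp only [lineSlash_apply, Pi.add_apply, mul_add]

/-- The slash commutes with subtraction. [cite: BruggemanLewisZagier2015, (2.1) p. 11] -/
theorem lineSlash_sub (g : GL (Fin 2) ℝ) (φ ψ : ℝ → ℂ) :
    lineSlash s g (φ - ψ) = lineSlash s g φ - lineSlash s g ψ := by
  funext t; simp only [lineSlash_apply, Pi.sub_apply, mul_sub]

/-- The slash of `0` is `0`. [cite: BruggemanLewisZagier2015, (2.1) p. 11] -/
@[simp] theorem lineSlash_zero (g : GL (Fin 2) ℝ) : lineSlash s g (0 : ℝ → ℂ) = 0 := by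
  funext t; simp [lineSlash_apply]

/-- The slash commutes with scalars commuting with `ℂ` (`ℚ`, `ℝ`, `ℂ`, …).
[cite: BruggemanLewisZagier2015, (2.1) p. 11] -/
theorem lineSlash_smul {R : Type*} [SMul R ℂ] [SMulCommClass R ℂ ℂ] (g : GL (Fin 2) ℝ) (c : R)
    (φ : ℝ → ℂ) : lineSlash s g (c • φ) = c • lineSlash s g φ := by
  funext t; simp only [lineSlash_apply, Pi.smul_apply, mul_smul_comm]

/-- Entries of the image in `GL₂(ℝ)` of an integer matrix `γ ∈ SL₂(ℤ)` (Mathlib's `mapGL ℝ`, the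
map through which `SL₂(ℤ)` acts on `ℍ`). [folklore] -/
theorem mapGL_real_apply (γ : SL(2, ℤ)) (i j : Fin 2) :
    ((Matrix.SpecialLinearGroup.mapGL ℝ γ : GL (Fin 2) ℝ) i j : ℝ) = ((γ i j : ℤ) : ℝ) :=
  rfl

/-- The slash by an integer matrix, written with integer entries.
[cite: BruggemanLewisZagier2015, (2.1) p. 11] -/
theorem lineSlash_mapGL_apply (γ : SL(2, ℤ)) (φ : ℝ → ℂ) (t : ℝ) :
    lineSlash s (Matrix.SpecialLinearGroup.mapGL ℝ γ) φ t =
      ((|((γ 1 0 : ℤ) : ℝ) * t + ((γ 1 1 : ℤ) : ℝ)| : ℝ) : ℂ) ^ (-(2 * s)) *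
        φ ((((γ 0 0 : ℤ) : ℝ) * t + ((γ 0 1 : ℤ) : ℝ)) /
          (((γ 1 0 : ℤ) : ℝ) * t + ((γ 1 1 : ℤ) : ℝ))) := by
  simp only [lineSlash_apply, mapGL_real_apply]

/-- **The `s = 1/2` action by integer matrices** `(φ|γ)(t) = |ct + d|⁻¹ φ((at + b)/(ct + d))`
(the `slashHalf` inlined in route `Langlands/RationalPeriodQuarter`).
[cite: BruggemanLewisZagier2015, (2.1) p. 11] -/
theorem lineSlash_mapGL_one_half (γ : SL(2, ℤ)) (φ : ℝ → ℂ) (t : ℝ) :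
    lineSlash (1 / 2) (Matrix.SpecialLinearGroup.mapGL ℝ γ) φ t =
      ((|((γ 1 0 : ℤ) : ℝ) * t + ((γ 1 1 : ℤ) : ℝ)|⁻¹ : ℝ) : ℂ) *
        φ ((((γ 0 0 : ℤ) : ℝ) * t + ((γ 0 1 : ℤ) : ℝ)) /
          (((γ 1 0 : ℤ) : ℝ) * t + ((γ 1 1 : ℤ) : ℝ))) := by
  simp only [lineSlash_one_half, mapGL_real_apply]

/-- The flip `S = (0 -1; 1 0) ∈ GL₂(ℝ)`; `(φ | S)(t) = |t|^{-2s} φ(-1/t)` is the chart at `∞` of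
the line model. [folklore] -/
def flipGL : GL (Fin 2) ℝ :=
  Matrix.GeneralLinearGroup.mkOfDetNeZero !![(0 : ℝ), -1; 1, 0]
    (by norm_num [Matrix.det_fin_two_of])

/-- Entry `(0,0)` of `S`. [folklore] -/
@[simp] theorem flipGL_apply_zero_zero : ((flipGL : GL (Fin 2) ℝ) 0 0 : ℝ) = 0 := rfl
/-- Entry `(0,1)` of `S`. [folklore] -/
@[simp] theorem flipGL_apply_zero_one : ((flipGL : GL (Fin 2) ℝ) 0 1 : ℝ) = -1 := rfl
/-- Entry `(1,0)` of `S`. [folklore] -/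
@[simp] theorem flipGL_apply_one_zero : ((flipGL : GL (Fin 2) ℝ) 1 0 : ℝ) = 1 := rfl
/-- Entry `(1,1)` of `S`. [folklore] -/
@[simp] theorem flipGL_apply_one_one : ((flipGL : GL (Fin 2) ℝ) 1 1 : ℝ) = 0 := rfl

/-- `S g = (-c, -d; a, b)`, first row. [folklore] -/
theorem flipGL_mul_apply_zero (g : GL (Fin 2) ℝ) (j : Fin 2) :
    ((flipGL * g : GL (Fin 2) ℝ) 0 j : ℝ) = -g 1 j := by
  rw [gl_mul_apply]; simp

/-- `S g = (-c, -d; a, b)`, second row. [folklore] -/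
theorem flipGL_mul_apply_one (g : GL (Fin 2) ℝ) (j : Fin 2) :
    ((flipGL * g : GL (Fin 2) ℝ) 1 j : ℝ) = g 0 j := by
  rw [gl_mul_apply]; simp

/-- `g S = (b, -a; d, -c)`, first column. [folklore] -/
theorem mul_flipGL_apply_zero (g : GL (Fin 2) ℝ) (i : Fin 2) :
    ((g * flipGL : GL (Fin 2) ℝ) i 0 : ℝ) = g i 1 := by
  rw [gl_mul_apply]; simp

/-- `g S = (b, -a; d, -c)`, second column. [folklore] -/
theorem mul_flipGL_apply_one (g : GL (Fin 2) ℝ) (i : Fin 2) :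
    ((g * flipGL : GL (Fin 2) ℝ) i 1 : ℝ) = -g i 0 := by
  rw [gl_mul_apply]; simp

/-- `S² = -1`. [folklore] -/
theorem flipGL_mul_flipGL : flipGL * flipGL = -1 := by
  refine Matrix.GeneralLinearGroup.ext fun i j => ?_
  have e : ∀ i j : Fin 2, ((-1 : GL (Fin 2) ℝ) i j : ℝ) = -((1 : Matrix (Fin 2) (Fin 2) ℝ) i j) := by
    intro i j; simp
  rw [e]
  fin_cases i <;> fin_cases j <;> simp [flipGL_mul_apply_zero, flipGL_mul_apply_one]

/-- `(φ |_{2s} S)(t) = |t|^{-2s} φ(-1/t)`. [cite: BruggemanLewisZagier2015, (2.2) p. 12] -/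
theorem lineSlash_flipGL_apply (φ : ℝ → ℂ) (t : ℝ) :
    lineSlash s flipGL φ t = ((|t| : ℝ) : ℂ) ^ (-(2 * s)) * φ (-1 / t) := by
  rw [lineSlash_apply]; simp

/-- **The slash through the chart at infinity**: off the pole of `S g` (i.e. for `at + b ≠ 0`),
`φ | g = (φ | S) | (S g)` (from `S² = -1`, `φ|(-h) = φ|h` and the action law).
[cite: BruggemanLewisZagier2015, (2.1) p. 11] -/
theorem lineSlash_eq_flip (g : GL (Fin 2) ℝ) (φ : ℝ → ℂ) {t : ℝ} (ht : (g 0 0 : ℝ) * t + g 0 1 ≠ 0) :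
    lineSlash s g φ t = lineSlash s (flipGL * g) (lineSlash s flipGL φ) t := by
  have hg : flipGL * (flipGL * g) = -g := by rw [← mul_assoc, flipGL_mul_flipGL, neg_one_mul]
  have ht' : ((flipGL * g : GL (Fin 2) ℝ) 1 0 : ℝ) * t + (flipGL * g : GL (Fin 2) ℝ) 1 1 ≠ 0 := by
    rwa [flipGL_mul_apply_one, flipGL_mul_apply_one]
  rw [← lineSlash_mul s flipGL (flipGL * g) φ ht', hg, lineSlash_neg]

/-- `φ | g` is `Cⁿ` at every non-pole `t` with `φ` `Cⁿ` at `g t` (the finite part of "the spaces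
`V_s^∞, …` are preserved under the action", p. 12). [cite: BruggemanLewisZagier2015, (2.1) p. 12] -/
theorem contDiffAt_lineSlash (g : GL (Fin 2) ℝ) {φ : ℝ → ℂ} {t : ℝ} {n : WithTop ℕ∞}
    (ht : (g 1 0 : ℝ) * t + g 1 1 ≠ 0)
    (hφ : ContDiffAt ℝ n φ ((g 0 0 * t + g 0 1) / (g 1 0 * t + g 1 1))) :
    ContDiffAt ℝ n (lineSlash s g φ) t := by
  have h2 : ContDiffAt ℝ n (fun x => φ ((g 0 0 * x + g 0 1) / (g 1 0 * x + g 1 1))) t :=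
    hφ.comp t (analyticAt_moebius g ht).contDiffAt
  exact (analyticAt_automorphyFactor s g ht).contDiffAt.mul h2

end Action

/-! ## 2. Functions modulo finite sets: the representation -/

section Germ

/-- **The line model modulo finite sets**: functions `ℝ → ℂ` up to agreement off a finite set
(Mathlib's `Filter.Germ` along the cofinite filter) — the common home of `V_s^ω[F]` for all finite
`F`, cf. `V_s^{ω*} = lim_F V_s^ω(P¹(ℝ) ∖ F)` ((2.22)). A `ℂ`-algebra.
[cite: BruggemanLewisZagier2015, (2.22) p. 16] -/
abbrev LineGerm : Type := Filter.Germ (cofinite : Filter ℝ) ℂ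

variable (s : ℂ)

/-- The slash `φ ↦ φ |_{2s} g` on functions modulo finite sets (well defined by
`lineSlash_congr_cofinite`), a `ℂ`-linear map. [cite: BruggemanLewisZagier2015, (2.1) p. 11] -/
def lineSlashGerm (g : GL (Fin 2) ℝ) : LineGerm →ₗ[ℂ] LineGerm where
  toFun := Filter.Germ.map' (lineSlash s g) fun _ _ h => lineSlash_congr_cofinite s g h
  map_add' x y := by
    induction x using Filter.Germ.inductionOn with
    | h φ =>
      induction y using Filter.Germ.inductionOn with
      | h ψ =>
        change (((lineSlash s g (φ + ψ) : ℝ → ℂ)) : LineGerm) =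
          ((lineSlash s g φ : ℝ → ℂ) : LineGerm) + ((lineSlash s g ψ : ℝ → ℂ) : LineGerm)
        rw [lineSlash_add]; rfl
  map_smul' c x := by
    induction x using Filter.Germ.inductionOn with
    | h φ =>
      change (((lineSlash s g (c • φ) : ℝ → ℂ)) : LineGerm) = c • ((lineSlash s g φ : ℝ → ℂ) : LineGerm)
      rw [lineSlash_smul]; rfl

/-- `lineSlashGerm` on a representative. [cite: BruggemanLewisZagier2015, (2.1) p. 11] -/
@[simp] theorem lineSlashGerm_coe (g : GL (Fin 2) ℝ) (φ : ℝ → ℂ) :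
    lineSlashGerm s g (φ : LineGerm) = ((lineSlash s g φ : ℝ → ℂ) : LineGerm) :=
  rfl

/-- The identity acts trivially on germs. [cite: BruggemanLewisZagier2015, (2.1) p. 11] -/
theorem lineSlashGerm_one : lineSlashGerm s 1 = LinearMap.id := by
  refine LinearMap.ext fun x => ?_
  induction x using Filter.Germ.inductionOn with
  | h φ => rw [lineSlashGerm_coe, lineSlash_one]; rfl

/-- **Modulo finite sets the line model is an honest right action**: `[φ|(gh)] = [(φ|g)|h]`.
[cite: BruggemanLewisZagier2015, (2.1) p. 11] -/
theorem lineSlashGerm_mul (g h : GL (Fin 2) ℝ) :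
    lineSlashGerm s (g * h) = (lineSlashGerm s h).comp (lineSlashGerm s g) := by
  refine LinearMap.ext fun x => ?_
  induction x using Filter.Germ.inductionOn with
  | h φ =>
    rw [LinearMap.comp_apply, lineSlashGerm_coe, lineSlashGerm_coe, lineSlashGerm_coe]
    exact Filter.Germ.coe_eq.2 (lineSlash_mul_eventuallyEq s g h φ)

/-- **The principal series `V_s` in its line model** ("we write `V_s` to denote 'the' principal
series representation when we do not want to specify precisely the space under consideration",
p. 11), realised on all functions `ℝ → ℂ` modulo finite sets: the right action (2.1) of `GL₂(ℝ)`
(determinant-free formula; for `det = 1` the action of `PSL₂(ℝ)`) as a `ℂ`-linear representation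
of the opposite group, `op g ↦ (φ ↦ φ |_{2s} g)`. The specific spaces `V_s^ω ⊂ V_s^∞`,
`V_s^{ω*,∞} ⊂ V_s^{ω*}` are the images of `IsAnalyticVector s`, `smoothLineVectors s`,
`smoothSemiAnalyticLineVectors s`, `semiAnalyticLineVectors`. [cite: BruggemanLewisZagier2015, (2.1) p. 11] -/
def principalSeriesLineModel : Representation ℂ (GL (Fin 2) ℝ)ᵐᵒᵖ LineGerm where
  toFun g := lineSlashGerm s g.unop
  map_one' := by rw [MulOpposite.unop_one, lineSlashGerm_one]; rfl
  map_mul' g h := by rw [MulOpposite.unop_mul, lineSlashGerm_mul]; rfl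

/-- `principalSeriesLineModel` on a representative. [cite: BruggemanLewisZagier2015, (2.1) p. 11] -/
@[simp] theorem principalSeriesLineModel_apply_coe (g : (GL (Fin 2) ℝ)ᵐᵒᵖ) (φ : ℝ → ℂ) :
    principalSeriesLineModel s g (φ : LineGerm) = ((lineSlash s g.unop φ : ℝ → ℂ) : LineGerm) :=
  rfl

/-- The line model as a representation of `Γᵐᵒᵖ` for a subgroup `Γ ≤ G` mapped to `GL₂(ℝ)` by
`ι` (e.g. `ι = Matrix.SpecialLinearGroup.mapGL ℝ`, `Γ = CongruenceSubgroup.Gamma1 N`); Mathlib's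
`groupCohomology.H1 (Rep.of (principalSeriesLineModelOf ι s Γ))` is then the group cohomology
of (5.4) (a left `1`-cocycle of `Γᵐᵒᵖ` is exactly `ψ_{γδ} = ψ_γ|δ + ψ_δ`).
[cite: BruggemanLewisZagier2015, (5.4) p. 29] -/
abbrev principalSeriesLineModelOf {G : Type*} [Group G] (ι : G →* GL (Fin 2) ℝ) (s : ℂ)
    (Γ : Subgroup G) :
    Representation ℂ (↥Γ)ᵐᵒᵖ LineGerm :=
  (principalSeriesLineModel s).comp (MonoidHom.op (ι.comp Γ.subtype))

end Germ

/-! ## 3. Smooth vectors `V_s^∞` and smooth semi-analytic vectors `V_s^{ω*,∞}` -/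

section Smooth

variable (s : ℂ)

/-- **Smooth vectors** `V_s^∞` of the principal series in the line model (p. 12): the `φ` whose
projective-model transform `φ^P(t) = (1+t²)^s φ(t)` ((2.3)) is `C^∞` on `P¹(ℝ)` ("(2.3) gives a
model for which `V_s^ω`, `V_s^∞` … correspond to `C^ω(P¹_ℝ)`, `C^∞(P¹_ℝ)` …"), which in the line
model reads: `φ` is `C^∞` on `ℝ` and `t ↦ |t|^{-2s} φ(-1/t)` (the slash of `φ` by `S = (0 -1; 1 0)`;
note `φ^P(-1/t) = (1+t²)^s · |t|^{-2s} φ(-1/t)`) agrees on `t ≠ 0` with a function `C^∞` at `0` —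
BLZ's asymptotic expansion `φ(t) ~ |t|^{-2s} Σₙ cₙ t⁻ⁿ` ((2.2)). The `C^∞` analogue of
`IsAnalyticVector`. [cite: BruggemanLewisZagier2015, (2.2)–(2.3) p. 12] -/
def IsSmoothVector (φ : ℝ → ℂ) : Prop :=
  ContDiff ℝ ∞ φ ∧
    ∃ ψ : ℝ → ℂ, ContDiffAt ℝ ∞ ψ 0 ∧
      ∀ t : ℝ, t ≠ 0 → ψ t = ((|t| : ℝ) : ℂ) ^ (-(2 * s)) * φ (-1 / t)

/-- **Smooth semi-analytic vectors** `V_s^{ω*,∞} = V_s^{ω*} ∩ V_s^∞` (§9.3, p. 51; the case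
`cond = ∞` of (2.23)): smooth vectors that are moreover real-analytic off a finite set. The period
functions of Maass cusp forms are elements of this space (Theorem B, p. 6; (12.6), (14.8a)).
[cite: BruggemanLewisZagier2015, §9.3 p. 51] -/
def IsSmoothSemiAnalyticVector (φ : ℝ → ℂ) : Prop :=
  IsSemiAnalyticVector φ ∧ IsSmoothVector s φ

variable {s}

/-- `V_s^ω ⊂ V_s^∞`. [cite: BruggemanLewisZagier2015, (2.18) p. 15] -/
theorem IsAnalyticVector.isSmoothVector {φ : ℝ → ℂ} (h : IsAnalyticVector s φ) :
    IsSmoothVector s φ := by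
  obtain ⟨hφ, ψ, hψ, hψφ⟩ := h
  exact ⟨contDiff_iff_contDiffAt.2 fun t => (hφ t (mem_univ t)).contDiffAt, ψ, hψ.contDiffAt, hψφ⟩

/-- `V_s^ω ⊂ V_s^{ω*,∞}`. [cite: BruggemanLewisZagier2015, §9.3 p. 51] -/
theorem IsAnalyticVector.isSmoothSemiAnalyticVector {φ : ℝ → ℂ} (h : IsAnalyticVector s φ) :
    IsSmoothSemiAnalyticVector s φ :=
  ⟨h.isSemiAnalyticVector, h.isSmoothVector⟩

/-- Non-vacuity: the spherical vector `e_{s,0} = (t²+1)^{-s}` is a smooth semi-analytic vector.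
[cite: BruggemanLewisZagier2015, (2.17a) p. 15] -/
theorem isSmoothSemiAnalyticVector_eSZero (s : ℂ) : IsSmoothSemiAnalyticVector s (eSZero s) :=
  (isAnalyticVector_eSZero s).isSmoothSemiAnalyticVector

variable (s)

/-- `0 ∈ V_s^∞`. [folklore] -/
theorem isSmoothVector_zero : IsSmoothVector s 0 :=
  (isAnalyticVector_zero s).isSmoothVector

variable {s}

/-- `V_s^∞` is closed under addition. [cite: BruggemanLewisZagier2015, (2.2) p. 12] -/
theorem IsSmoothVector.add {φ φ' : ℝ → ℂ} (h : IsSmoothVector s φ) (h' : IsSmoothVector s φ') :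
    IsSmoothVector s (φ + φ') := by
  obtain ⟨hφ, ψ, hψ, hψφ⟩ := h
  obtain ⟨hφ', ψ', hψ', hψφ'⟩ := h'
  refine ⟨hφ.add hφ', ψ + ψ', hψ.add hψ', fun t ht => ?_⟩
  simp only [Pi.add_apply, hψφ t ht, hψφ' t ht, mul_add]

/-- `V_s^∞` is closed under complex scalars. [cite: BruggemanLewisZagier2015, (2.2) p. 12] -/
theorem IsSmoothVector.smul {φ : ℝ → ℂ} (h : IsSmoothVector s φ) (c : ℂ) :
    IsSmoothVector s (c • φ) := by
  obtain ⟨hφ, ψ, hψ, hψφ⟩ := h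
  refine ⟨contDiff_const.smul hφ, c • ψ, contDiffAt_const.smul hψ, fun t ht => ?_⟩
  simp only [Pi.smul_apply, hψφ t ht, smul_eq_mul]
  ring

variable (s)

/-- The function in the chart at `∞` of a smooth vector is `C^∞` on all of `ℝ` (off `0` it is
`φ | S`, smooth at non-poles of `S`). [cite: BruggemanLewisZagier2015, (2.2) p. 12] -/
theorem IsSmoothVector.contDiff_flip {φ ψ : ℝ → ℂ} (hφ : ContDiff ℝ ∞ φ)
    (hψ : ContDiffAt ℝ ∞ ψ 0)
    (hψφ : ∀ t : ℝ, t ≠ 0 → ψ t = ((|t| : ℝ) : ℂ) ^ (-(2 * s)) * φ (-1 / t)) :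
    ContDiff ℝ ∞ ψ := by
  refine contDiff_iff_contDiffAt.2 fun t => ?_
  by_cases ht : t = 0
  · exact ht ▸ hψ
  · have he : ψ =ᶠ[𝓝 t] lineSlash s flipGL φ := by
      filter_upwards [isOpen_ne.mem_nhds ht] with u hu
      rw [hψφ u hu, lineSlash_flipGL_apply]
    refine (contDiffAt_lineSlash s flipGL ?_ hφ.contDiffAt).congr_of_eventuallyEq he
    simpa using ht

/-- **The regularised slash** `φ ‖ g`: `φ | g` with its removable singularity at the pole of `g`
filled in through the chart at infinity (`ψ` is the smooth function equal to `φ | S` off `0`;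
off the pole of `S g` one has `φ | g = (φ|S) | (S g)`, `lineSlash_eq_flip`). Agrees with
`lineSlash s g φ` off the pole. [cite: BruggemanLewisZagier2015, (2.1)–(2.4) pp. 11–12] -/
def lineSlashReg (s : ℂ) (g : GL (Fin 2) ℝ) (ψ φ : ℝ → ℂ) (t : ℝ) : ℂ :=
  if (g 1 0 : ℝ) * t + g 1 1 = 0 then lineSlash s (flipGL * g) ψ t else lineSlash s g φ t

/-- `φ ‖ g ≡ φ | g` off the (finite) pole set. [cite: BruggemanLewisZagier2015, (2.1) p. 11] -/
theorem lineSlashReg_eventuallyEq (g : GL (Fin 2) ℝ) (ψ φ : ℝ → ℂ) :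
    lineSlashReg s g ψ φ =ᶠ[cofinite] lineSlash s g φ :=
  (eventually_cofinite_ne_linePole g).mono fun t ht => by simp [lineSlashReg, ht]

/-- Near the pole of `g` (precisely: off the pole of `S g`), `φ ‖ g = ψ | (S g)`.
[cite: BruggemanLewisZagier2015, (2.4) p. 12] -/
theorem lineSlashReg_eq_of_ne (g : GL (Fin 2) ℝ) {ψ φ : ℝ → ℂ}
    (hψφ : ∀ t : ℝ, t ≠ 0 → ψ t = ((|t| : ℝ) : ℂ) ^ (-(2 * s)) * φ (-1 / t)) {t : ℝ}
    (ht : (g 0 0 : ℝ) * t + g 0 1 ≠ 0) :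
    lineSlashReg s g ψ φ t = lineSlash s (flipGL * g) ψ t := by
  by_cases hp : (g 1 0 : ℝ) * t + g 1 1 = 0
  · simp [lineSlashReg, hp]
  · rw [lineSlashReg, if_neg hp, lineSlash_eq_flip s g φ ht]
    simp only [lineSlash_apply (φ := ψ), lineSlash_apply (φ := lineSlash s flipGL φ)]
    congr 1
    have hM : ((flipGL * g : GL (Fin 2) ℝ) 0 0 * t + (flipGL * g : GL (Fin 2) ℝ) 0 1) /
        ((flipGL * g : GL (Fin 2) ℝ) 1 0 * t + (flipGL * g : GL (Fin 2) ℝ) 1 1) ≠ 0 := by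
      rw [flipGL_mul_apply_zero, flipGL_mul_apply_zero, flipGL_mul_apply_one,
        flipGL_mul_apply_one]
      refine div_ne_zero ?_ ht
      intro h0; apply hp; linarith
    rw [hψφ _ hM, lineSlash_flipGL_apply]

/-- **`φ ‖ g` is `C^∞` everywhere** for `φ ∈ V_s^∞`: at a non-pole it is locally `φ | g`; at
the pole `t₀` it is locally `ψ | (S g)` and `t₀` is not a pole of `S g`.
[cite: BruggemanLewisZagier2015, (2.1)–(2.4) pp. 11–12] -/
theorem contDiffAt_lineSlashReg (g : GL (Fin 2) ℝ) {ψ φ : ℝ → ℂ} (hφ : ContDiff ℝ ∞ φ)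
    (hψ : ContDiff ℝ ∞ ψ)
    (hψφ : ∀ t : ℝ, t ≠ 0 → ψ t = ((|t| : ℝ) : ℂ) ^ (-(2 * s)) * φ (-1 / t)) (t₀ : ℝ) :
    ContDiffAt ℝ ∞ (lineSlashReg s g ψ φ) t₀ := by
  by_cases hp : (g 1 0 : ℝ) * t₀ + g 1 1 = 0
  · -- the pole: `a t₀ + b ≠ 0` since `det g ≠ 0`
    have ha : (g 0 0 : ℝ) * t₀ + g 0 1 ≠ 0 := by
      intro ha
      have h1 : ((g : GL (Fin 2) ℝ) : Matrix (Fin 2) (Fin 2) ℝ).det ≠ 0 :=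
        Matrix.GeneralLinearGroup.det_ne_zero g
      rw [Matrix.det_fin_two] at h1
      apply h1
      have e1 : (g 0 1 : ℝ) = -(g 0 0 * t₀) := by linarith
      have e2 : (g 1 1 : ℝ) = -(g 1 0 * t₀) := by linarith
      rw [e1, e2]; ring
    have hev : ∀ᶠ t in 𝓝 t₀, (g 0 0 : ℝ) * t + g 0 1 ≠ 0 := by
      have hc : Continuous fun t : ℝ => (g 0 0 : ℝ) * t + g 0 1 := by fun_prop
      exact hc.continuousAt.eventually_ne ha
    have he : lineSlashReg s g ψ φ =ᶠ[𝓝 t₀] lineSlash s (flipGL * g) ψ :=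
      hev.mono fun t ht => lineSlashReg_eq_of_ne s g hψφ ht
    refine (contDiffAt_lineSlash s (flipGL * g) ?_ hψ.contDiffAt).congr_of_eventuallyEq he
    rwa [flipGL_mul_apply_one, flipGL_mul_apply_one]
  · have hev : ∀ᶠ t in 𝓝 t₀, (g 1 0 : ℝ) * t + g 1 1 ≠ 0 := by
      have hc : Continuous fun t : ℝ => (g 1 0 : ℝ) * t + g 1 1 := by fun_prop
      exact hc.continuousAt.eventually_ne hp
    have he : lineSlashReg s g ψ φ =ᶠ[𝓝 t₀] lineSlash s g φ :=
      hev.mono fun t ht => by simp [lineSlashReg, ht]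
    exact (contDiffAt_lineSlash s g hp hφ.contDiffAt).congr_of_eventuallyEq he

/-- **The chart at infinity of `φ ‖ g` is `φ ‖ (g S)`**: for `u ≠ 0`,
`|u|^{-2s} (φ ‖ g)(-1/u) = (φ ‖ (g S))(u)`. [cite: BruggemanLewisZagier2015, (2.4) p. 12] -/
theorem lineSlashReg_flip (g : GL (Fin 2) ℝ) (ψ φ : ℝ → ℂ) {u : ℝ} (hu : u ≠ 0) :
    ((|u| : ℝ) : ℂ) ^ (-(2 * s)) * lineSlashReg s g ψ φ (-1 / u) =
      lineSlashReg s (g * flipGL) ψ φ u := by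
  have hS : ((flipGL : GL (Fin 2) ℝ) 1 0 : ℝ) * u + (flipGL : GL (Fin 2) ℝ) 1 1 ≠ 0 := by
    simpa using hu
  -- `-1/u` is the pole of `g` iff `u` is the pole of `g S`
  have hiff : (g 1 0 : ℝ) * (-1 / u) + g 1 1 = 0 ↔
      ((g * flipGL : GL (Fin 2) ℝ) 1 0 : ℝ) * u + (g * flipGL : GL (Fin 2) ℝ) 1 1 = 0 := by
    rw [mul_flipGL_apply_zero, mul_flipGL_apply_one]
    constructor
    · intro h; field_simp at h; linarith
    · intro h; field_simp; linarith
  by_cases hp : (g 1 0 : ℝ) * (-1 / u) + g 1 1 = 0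
  · rw [lineSlashReg, if_pos hp, lineSlashReg, if_pos (hiff.1 hp), ← mul_assoc,
      lineSlash_mul s (flipGL * g) flipGL ψ hS, lineSlash_flipGL_apply]
  · rw [lineSlashReg, if_neg hp, lineSlashReg, if_neg (fun h => hp (hiff.2 h)),
      lineSlash_mul s g flipGL φ hS, lineSlash_flipGL_apply]

variable {s}

/-- **`V_s^∞` is preserved by the action** ("it requires some work to check that the spaces
`V_s^ω, V_s^∞, …` are preserved under the action of `G`", p. 12), in the line model with total
functions: `φ | g` agrees off a finite set (the pole, where `lineSlash` has a junk value) with a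
smooth vector, namely `φ ‖ g`. [cite: BruggemanLewisZagier2015, (2.1)–(2.4) pp. 11–12] -/
theorem IsSmoothVector.lineSlash {φ : ℝ → ℂ} (h : IsSmoothVector s φ) (g : GL (Fin 2) ℝ) :
    ∃ φ' : ℝ → ℂ, IsSmoothVector s φ' ∧ φ' =ᶠ[cofinite] lineSlash s g φ := by
  obtain ⟨hφ, ψ, hψ0, hψφ⟩ := h
  have hψ : ContDiff ℝ ∞ ψ := IsSmoothVector.contDiff_flip s hφ hψ0 hψφ
  refine ⟨lineSlashReg s g ψ φ, ⟨contDiff_iff_contDiffAt.2 fun t =>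
    contDiffAt_lineSlashReg s g hφ hψ hψφ t, lineSlashReg s (g * flipGL) ψ φ,
    contDiffAt_lineSlashReg s (g * flipGL) hφ hψ hψφ 0, fun u hu =>
    (lineSlashReg_flip s g ψ φ hu).symm⟩, lineSlashReg_eventuallyEq s g ψ φ⟩

/-- **`V_s^{ω*,∞}` is preserved by the action** (it is a `G`-module, §9.3 p. 51): `φ | g` agrees
off a finite set with a smooth semi-analytic vector.
[cite: BruggemanLewisZagier2015, §9.3 p. 51] -/
theorem IsSmoothSemiAnalyticVector.lineSlash {φ : ℝ → ℂ} (h : IsSmoothSemiAnalyticVector s φ)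
    (g : GL (Fin 2) ℝ) :
    ∃ φ' : ℝ → ℂ, IsSmoothSemiAnalyticVector s φ' ∧ φ' =ᶠ[cofinite] lineSlash s g φ := by
  obtain ⟨φ', h', he⟩ := h.2.lineSlash g
  exact ⟨φ', ⟨(h.1.lineSlash s g).congr_cofinite (he.symm.mono fun _ ht => ht), h'⟩, he⟩

end Smooth

/-! ## 4. Coefficient modules: `V_s^{ω*}`, `V_s^∞`, `V_s^{ω*,∞}` as `ℂ`-submodules of functions -/

section Modules

/-- `V_s^{ω*}` is closed under addition (union of the singular sets).
[cite: BruggemanLewisZagier2015, (2.22) p. 16] -/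
theorem IsSemiAnalyticVector.add {φ ψ : ℝ → ℂ} (hφ : IsSemiAnalyticVector φ)
    (hψ : IsSemiAnalyticVector ψ) : IsSemiAnalyticVector (φ + ψ) := by
  classical
  obtain ⟨F, hF⟩ := hφ
  obtain ⟨F', hF'⟩ := hψ
  refine ⟨F ∪ F', fun t ht => ?_⟩
  simp only [Finset.coe_union, compl_union, mem_inter_iff, mem_compl_iff, Finset.mem_coe] at ht
  exact (hF t (by simpa using ht.1)).add (hF' t (by simpa using ht.2))

/-- `V_s^{ω*}` is closed under subtraction. [cite: BruggemanLewisZagier2015, (2.22) p. 16] -/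
theorem IsSemiAnalyticVector.sub {φ ψ : ℝ → ℂ} (hφ : IsSemiAnalyticVector φ)
    (hψ : IsSemiAnalyticVector ψ) : IsSemiAnalyticVector (φ - ψ) := by
  classical
  obtain ⟨F, hF⟩ := hφ
  obtain ⟨F', hF'⟩ := hψ
  refine ⟨F ∪ F', fun t ht => ?_⟩
  simp only [Finset.coe_union, compl_union, mem_inter_iff, mem_compl_iff, Finset.mem_coe] at ht
  exact (hF t (by simpa using ht.1)).sub (hF' t (by simpa using ht.2))

/-- `V_s^{ω*}` is closed under complex scalars. [cite: BruggemanLewisZagier2015, (2.22) p. 16] -/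
theorem IsSemiAnalyticVector.smul {φ : ℝ → ℂ} (hφ : IsSemiAnalyticVector φ) (c : ℂ) :
    IsSemiAnalyticVector (c • φ) := by
  obtain ⟨F, hF⟩ := hφ
  exact ⟨F, fun t ht => (analyticAt_const.smul (hF t ht) : _)⟩

/-- **`V_s^{ω*}`** as a `ℂ`-submodule of functions `ℝ → ℂ` (as a set of functions it does not
depend on `s`; the action `lineSlash s` does). [cite: BruggemanLewisZagier2015, (2.22) p. 16] -/
def semiAnalyticLineVectors : Submodule ℂ (ℝ → ℂ) where
  carrier := {φ | IsSemiAnalyticVector φ}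
  add_mem' := fun h h' => h.add h'
  zero_mem' := ⟨∅, fun _ _ => analyticAt_const⟩
  smul_mem' := fun c _ h => h.smul c

/-- Membership in `semiAnalyticLineVectors`. [cite: BruggemanLewisZagier2015, (2.22) p. 16] -/
@[simp] theorem mem_semiAnalyticLineVectors {φ : ℝ → ℂ} :
    φ ∈ semiAnalyticLineVectors ↔ IsSemiAnalyticVector φ :=
  Iff.rfl

/-- **`V_s^∞`** as a `ℂ`-submodule of functions. [cite: BruggemanLewisZagier2015, (2.2) p. 12] -/
def smoothLineVectors (s : ℂ) : Submodule ℂ (ℝ → ℂ) where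
  carrier := {φ | IsSmoothVector s φ}
  add_mem' := fun h h' => h.add h'
  zero_mem' := isSmoothVector_zero s
  smul_mem' := fun c _ h => h.smul c

/-- Membership in `smoothLineVectors`. [cite: BruggemanLewisZagier2015, (2.2) p. 12] -/
@[simp] theorem mem_smoothLineVectors {s : ℂ} {φ : ℝ → ℂ} :
    φ ∈ smoothLineVectors s ↔ IsSmoothVector s φ :=
  Iff.rfl

/-- **`V_s^{ω*,∞} = V_s^{ω*} ∩ V_s^∞`** as a `ℂ`-submodule of functions.
[cite: BruggemanLewisZagier2015, §9.3 p. 51] -/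
def smoothSemiAnalyticLineVectors (s : ℂ) : Submodule ℂ (ℝ → ℂ) :=
  semiAnalyticLineVectors ⊓ smoothLineVectors s

/-- Membership in `smoothSemiAnalyticLineVectors`. [cite: BruggemanLewisZagier2015, §9.3 p. 51] -/
@[simp] theorem mem_smoothSemiAnalyticLineVectors {s : ℂ} {φ : ℝ → ℂ} :
    φ ∈ smoothSemiAnalyticLineVectors s ↔ IsSmoothSemiAnalyticVector s φ :=
  Iff.rfl

/-- `V_s^{ω*}` is stable under the action, submodule form.
[cite: BruggemanLewisZagier2015, (2.22) p. 16] -/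
theorem lineSlash_mem_semiAnalyticLineVectors (s : ℂ) (g : GL (Fin 2) ℝ) {φ : ℝ → ℂ}
    (h : φ ∈ semiAnalyticLineVectors) : lineSlash s g φ ∈ semiAnalyticLineVectors :=
  IsSemiAnalyticVector.lineSlash s g h

end Modules

/-! ## 5. Cocycles, coboundaries and `H¹` with values in line-model modules -/

section Cohomology

variable {G : Type*} [Group G] (ι : G →* GL (Fin 2) ℝ) (s : ℂ) (Γ : Subgroup G)

/-- **Inhomogeneous `1`-cocycles** for the right action `lineSlash s` ((5.4), p. 29:
`Z¹(Γ; V) = {ψ : Γ → V : ψ_{γδ} = ψ_γ | δ + ψ_δ}`), for cochains `r : G → (ℝ → ℂ)` on a group `G`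
mapped to `GL₂(ℝ)` by `ι` (e.g. `ι = Matrix.SpecialLinearGroup.mapGL ℝ` on `SL₂(ℤ)`) and a subgroup
`Γ`; as everywhere in the line model the identity is required off a finite subset of `ℝ`. Only the
values of `r` on `Γ` matter. [cite: BruggemanLewisZagier2015, (5.4) p. 29] -/
def IsLineCocycle (r : G → ℝ → ℂ) : Prop :=
  ∀ γ ∈ Γ, ∀ δ ∈ Γ, r (γ * δ) =ᶠ[cofinite] lineSlash s (ι δ) (r γ) + r δ

/-- **The coboundary of `f`**: `γ ↦ f | (γ - 1) = f|γ - f` ((5.4): `B¹(Γ; V) = {γ ↦ v|(γ-1)}`).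
[cite: BruggemanLewisZagier2015, (5.4) p. 29] -/
def lineCoboundary (f : ℝ → ℂ) : G → ℝ → ℂ := fun γ => lineSlash s (ι γ) f - f

/-- Unfolding of `lineCoboundary`. [cite: BruggemanLewisZagier2015, (5.4) p. 29] -/
theorem lineCoboundary_apply (f : ℝ → ℂ) (γ : G) (t : ℝ) :
    lineCoboundary ι s f γ t = lineSlash s (ι γ) f t - f t :=
  rfl

/-- `r` and `r'` are **cohomologous modulo coboundaries from `W`**: `r ≡ r' + δf` on `Γ`, off
finite sets, for some `f ∈ W`. [cite: BruggemanLewisZagier2015, (5.4) p. 29] -/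
def IsLineCohomologous (W : Set (ℝ → ℂ)) (r r' : G → ℝ → ℂ) : Prop :=
  ∃ f ∈ W, ∀ γ ∈ Γ, r γ =ᶠ[cofinite] r' γ + lineCoboundary ι s f γ

variable {ι s Γ}

/-- The zero cochain is a cocycle. [folklore] -/
theorem isLineCocycle_zero : IsLineCocycle ι s Γ 0 := fun γ _ δ _ =>
  Eventually.of_forall fun t => by simp

/-- Cocycles are stable under addition. [cite: BruggemanLewisZagier2015, (5.4) p. 29] -/
theorem IsLineCocycle.add {r r' : G → ℝ → ℂ} (h : IsLineCocycle ι s Γ r)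
    (h' : IsLineCocycle ι s Γ r') : IsLineCocycle ι s Γ (r + r') := by
  intro γ hγ δ hδ
  filter_upwards [h γ hγ δ hδ, h' γ hγ δ hδ] with t h1 h2
  simp only [Pi.add_apply] at h1 h2 ⊢
  rw [h1, h2, lineSlash_add, Pi.add_apply]
  ring

/-- Cocycles are stable under scalars commuting with `ℂ`. [cite: BruggemanLewisZagier2015, (5.4) p. 29] -/
theorem IsLineCocycle.smul {R : Type*} [DistribSMul R ℂ] [SMulCommClass R ℂ ℂ] {r : G → ℝ → ℂ}
    (h : IsLineCocycle ι s Γ r) (c : R) : IsLineCocycle ι s Γ (c • r) := by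
  intro γ hγ δ hδ
  filter_upwards [h γ hγ δ hδ] with t h1
  simp only [Pi.smul_apply, Pi.add_apply] at h1 ⊢
  rw [h1, lineSlash_smul, Pi.smul_apply, smul_add]

/-- A cochain agreeing with a cocycle on `Γ` off finite sets is a cocycle. [folklore] -/
theorem IsLineCocycle.congr {r r' : G → ℝ → ℂ} (h : IsLineCocycle ι s Γ r)
    (he : ∀ γ ∈ Γ, r γ =ᶠ[cofinite] r' γ) : IsLineCocycle ι s Γ r' := by
  intro γ hγ δ hδ
  filter_upwards [h γ hγ δ hδ, he _ (Γ.mul_mem hγ hδ), he δ hδ,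
    lineSlash_congr_cofinite s (ι δ) (he γ hγ)] with t h1 h2 h3 h4
  simp only [Pi.add_apply] at h1 ⊢
  rw [← h2, h1, h3, h4]

variable (ι s Γ)

/-- **Coboundaries are cocycles** (off finite sets): `f|(γδ) - f ≡ (f|γ - f)|δ + (f|δ - f)` by
the action law. [cite: BruggemanLewisZagier2015, (5.4) p. 29] -/
theorem isLineCocycle_lineCoboundary (f : ℝ → ℂ) : IsLineCocycle ι s Γ (lineCoboundary ι s f) := by
  intro γ _ δ _
  filter_upwards [eventually_cofinite_ne_linePole (ι δ)] with t ht
  simp only [lineCoboundary, map_mul, Pi.add_apply, Pi.sub_apply, lineSlash_sub]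
  rw [lineSlash_mul s (ι γ) (ι δ) f ht]
  ring

/-- `δ` is additive. [cite: BruggemanLewisZagier2015, (5.4) p. 29] -/
theorem lineCoboundary_add (f f' : ℝ → ℂ) :
    lineCoboundary ι s (f + f') = lineCoboundary ι s f + lineCoboundary ι s f' := by
  funext γ
  simp only [lineCoboundary, Pi.add_apply, lineSlash_add]
  abel

/-- `δ` commutes with scalars commuting with `ℂ`. [cite: BruggemanLewisZagier2015, (5.4) p. 29] -/
theorem lineCoboundary_smul {R : Type*} [Monoid R] [DistribMulAction R ℂ] [SMulCommClass R ℂ ℂ]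
    (c : R) (f : ℝ → ℂ) : lineCoboundary ι s (c • f) = c • lineCoboundary ι s f := by
  funext γ
  simp only [lineCoboundary, Pi.smul_apply, lineSlash_smul, smul_sub]

/-- `δ 0 = 0`. [folklore] -/
@[simp] theorem lineCoboundary_zero : lineCoboundary ι s (0 : ℝ → ℂ) = 0 := by
  funext γ; simp [lineCoboundary]

variable {R : Type*} [Ring R] [Module R ℂ] [SMulCommClass R ℂ ℂ]

/-- **`Z¹(Γ; W)`**: cochains with values in the coefficient module `W` on `Γ` (an `R`-submodule
of functions, e.g. `R = ℂ` and `W` the semi-analytic vectors, or `R = ℚ` and a `ℚ`-form)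
satisfying the cocycle identity off finite sets. [cite: BruggemanLewisZagier2015, (5.4) p. 29] -/
def lineCocycles (W : Submodule R (ℝ → ℂ)) : Submodule R (G → ℝ → ℂ) where
  carrier := {r | (∀ γ ∈ Γ, r γ ∈ W) ∧ IsLineCocycle ι s Γ r}
  add_mem' := fun hr hr' =>
    ⟨fun γ hγ => W.add_mem (hr.1 γ hγ) (hr'.1 γ hγ), hr.2.add hr'.2⟩
  zero_mem' := ⟨fun _ _ => W.zero_mem, isLineCocycle_zero⟩
  smul_mem' := fun c _ hr => ⟨fun γ hγ => W.smul_mem c (hr.1 γ hγ), hr.2.smul c⟩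

/-- Membership in `Z¹(Γ; W)`. [cite: BruggemanLewisZagier2015, (5.4) p. 29] -/
theorem mem_lineCocycles {W : Submodule R (ℝ → ℂ)} {r : G → ℝ → ℂ} :
    r ∈ lineCocycles ι s Γ W ↔ (∀ γ ∈ Γ, r γ ∈ W) ∧ IsLineCocycle ι s Γ r :=
  Iff.rfl

/-- **`B¹(Γ; W)`**: cochains that agree on `Γ`, off finite sets, with the coboundary
`γ ↦ f|γ - f` of some `f ∈ W`. [cite: BruggemanLewisZagier2015, (5.4) p. 29] -/
def lineCoboundaries (W : Submodule R (ℝ → ℂ)) : Submodule R (G → ℝ → ℂ) where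
  carrier := {r | ∃ f ∈ W, ∀ γ ∈ Γ, r γ =ᶠ[cofinite] lineCoboundary ι s f γ}
  add_mem' := fun hr hr' => by
    obtain ⟨f, hf, hrf⟩ := hr
    obtain ⟨f', hf', hrf'⟩ := hr'
    refine ⟨f + f', W.add_mem hf hf', fun γ hγ => ?_⟩
    rw [lineCoboundary_add]
    exact (hrf γ hγ).add (hrf' γ hγ)
  zero_mem' := ⟨0, W.zero_mem, fun _ _ => by simp⟩
  smul_mem' := fun c _ hr => by
    obtain ⟨f, hf, hrf⟩ := hr
    refine ⟨c • f, W.smul_mem c hf, fun γ hγ => ?_⟩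
    rw [lineCoboundary_smul]
    exact (hrf γ hγ).const_smul c

/-- Membership in `B¹(Γ; W)`. [cite: BruggemanLewisZagier2015, (5.4) p. 29] -/
theorem mem_lineCoboundaries {W : Submodule R (ℝ → ℂ)} {r : G → ℝ → ℂ} :
    r ∈ lineCoboundaries ι s Γ W ↔ ∃ f ∈ W, ∀ γ ∈ Γ, r γ =ᶠ[cofinite] lineCoboundary ι s f γ :=
  Iff.rfl

/-- **`H¹(Γ; W) = Z¹(Γ; W)/B¹(Γ; W)`** ((5.4), p. 29), as the quotient `R`-module of the cocycles
by the cocycles that are coboundaries of elements of `W`.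
[cite: BruggemanLewisZagier2015, (5.4) p. 29] -/
abbrev LineH1 (W : Submodule R (ℝ → ℂ)) : Type _ :=
  ↥(lineCocycles ι s Γ W) ⧸ (lineCoboundaries ι s Γ W).comap (lineCocycles ι s Γ W).subtype

/-- The class in `H¹(Γ; W)` of a cocycle. [cite: BruggemanLewisZagier2015, (5.4) p. 29] -/
abbrev LineH1.mk {W : Submodule R (ℝ → ℂ)} (r : lineCocycles ι s Γ W) : LineH1 ι s Γ W :=
  Submodule.Quotient.mk r

/-- Two cocycles have the same class in `H¹(Γ; W)` iff they are cohomologous modulo coboundaries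
from `W`. [cite: BruggemanLewisZagier2015, (5.4) p. 29] -/
theorem LineH1.mk_eq_mk_iff {W : Submodule R (ℝ → ℂ)} (r r' : lineCocycles ι s Γ W) :
    LineH1.mk ι s Γ r = LineH1.mk ι s Γ r' ↔
      IsLineCohomologous ι s Γ (W : Set (ℝ → ℂ)) (r : G → ℝ → ℂ) (r' : G → ℝ → ℂ) := by
  rw [LineH1.mk, LineH1.mk, Submodule.Quotient.eq, Submodule.mem_comap, Submodule.subtype_apply,
    mem_lineCoboundaries]
  constructor
  · rintro ⟨f, hf, h⟩
    refine ⟨f, hf, fun γ hγ => ?_⟩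
    filter_upwards [h γ hγ] with t ht
    simp only [Submodule.coe_sub, Pi.sub_apply] at ht
    simp only [Pi.add_apply]
    rw [← ht]; ring
  · rintro ⟨f, hf, h⟩
    refine ⟨f, hf, fun γ hγ => ?_⟩
    filter_upwards [h γ hγ] with t ht
    simp only [Pi.add_apply] at ht
    simp only [Submodule.coe_sub, Pi.sub_apply]
    rw [ht]; ring


/-- Coboundaries of semi-analytic vectors are cocycles with values in `V_s^{ω*}` (the values
`f|γ - f` are semi-analytic by stability of `V_s^{ω*}`). [cite: BruggemanLewisZagier2015, (5.4) p. 29] -/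
theorem lineCoboundary_mem_lineCocycles {f : ℝ → ℂ} (hf : IsSemiAnalyticVector f) :
    lineCoboundary ι s f ∈ lineCocycles ι s Γ semiAnalyticLineVectors :=
  ⟨fun γ _ => (hf.lineSlash s (ι γ)).sub hf, isLineCocycle_lineCoboundary ι s Γ f⟩

/-- **(5.4) is Mathlib's `Z¹` for the opposite group**: `r` satisfies the right-module cocycle
identity `r_{γδ} ≡ r_γ|δ + r_δ` on `Γ` iff `op γ ↦ [r γ]` is a `1`-cocycle of `Γᵐᵒᵖ` with values in
the germ representation `principalSeriesLineModelOf ι s Γ` in the sense of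
`groupCohomology.cocycles₁` (`f (g h) = ρ(g) f(h) + f(g)`). [cite: BruggemanLewisZagier2015, (5.4) p. 29] -/
theorem isLineCocycle_iff_mem_cocycles₁ {G : Type} [Group G] (ι : G →* GL (Fin 2) ℝ) (s : ℂ)
    (Γ : Subgroup G) (r : G → ℝ → ℂ) :
    IsLineCocycle ι s Γ r ↔
      (fun γ : (↥Γ)ᵐᵒᵖ => ((r (γ.unop : G) : ℝ → ℂ) : LineGerm)) ∈
        groupCohomology.cocycles₁ (Rep.of (principalSeriesLineModelOf ι s Γ)) := by
  rw [groupCohomology.mem_cocycles₁_iff]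
  have key : ∀ γ δ : ↥Γ,
      ((fun γ : (↥Γ)ᵐᵒᵖ => ((r (γ.unop : G) : ℝ → ℂ) : LineGerm))
          (MulOpposite.op δ * MulOpposite.op γ) =
        (Rep.of (principalSeriesLineModelOf ι s Γ)).ρ (MulOpposite.op δ)
          ((fun γ : (↥Γ)ᵐᵒᵖ => ((r (γ.unop : G) : ℝ → ℂ) : LineGerm)) (MulOpposite.op γ)) +
        (fun γ : (↥Γ)ᵐᵒᵖ => ((r (γ.unop : G) : ℝ → ℂ) : LineGerm)) (MulOpposite.op δ)) ↔
      r (γ * δ) =ᶠ[cofinite] lineSlash s (ι δ) (r γ) + r δ := by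
    intro γ δ
    simp only [← MulOpposite.op_mul, MulOpposite.unop_op, Subgroup.coe_mul]
    rw [show principalSeriesLineModelOf ι s Γ (MulOpposite.op δ) = lineSlashGerm s (ι δ) from rfl,
      lineSlashGerm_coe, ← Filter.Germ.coe_add, Filter.Germ.coe_eq]
  constructor
  · intro h g k
    induction g using MulOpposite.rec' with
    | h δ =>
      induction k using MulOpposite.rec' with
      | h γ => exact (key γ δ).2 (h γ γ.2 δ δ.2)
  · intro h γ hγ δ hδ
    exact (key ⟨γ, hγ⟩ ⟨δ, hδ⟩).1 (h _ _)

end Cohomology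


/-! ## 6. The germ subrepresentations `V_s^{ω*}` and `V_s^{ω*,∞}` -/

section Subrep

variable (s : ℂ)

/-- Functions to germs modulo finite sets, as a `ℂ`-linear map. [folklore] -/
def lineGermMk : (ℝ → ℂ) →ₗ[ℂ] LineGerm where
  toFun φ := (φ : LineGerm)
  map_add' _ _ := rfl
  map_smul' _ _ := rfl

/-- `lineGermMk φ = [φ]`. [folklore] -/
@[simp] theorem lineGermMk_apply (φ : ℝ → ℂ) : lineGermMk φ = (φ : LineGerm) := rfl

/-- **`V_s^{ω*}` in the germ model**: the germs with a semi-analytic representative form a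
subrepresentation of `principalSeriesLineModel s` (stability: `IsSemiAnalyticVector.lineSlash`).
This is BLZ's `G`-module `V_s^{ω*}` of (2.22) on the nose (sections over cofinite subsets of
`P¹(ℝ)`, identified when they agree off a finite set). [cite: BruggemanLewisZagier2015, (2.22) p. 16] -/
def semiAnalyticSubrep : Subrepresentation (principalSeriesLineModel s) where
  toSubmodule := semiAnalyticLineVectors.map lineGermMk
  apply_mem_toSubmodule g := by
    rintro _ ⟨φ, hφ, rfl⟩
    exact ⟨lineSlash s g.unop φ, IsSemiAnalyticVector.lineSlash s g.unop hφ, rfl⟩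

/-- Membership in the germ model of `V_s^{ω*}`. [cite: BruggemanLewisZagier2015, (2.22) p. 16] -/
theorem mem_semiAnalyticSubrep {x : LineGerm} :
    x ∈ (semiAnalyticSubrep s).toSubmodule ↔ ∃ φ : ℝ → ℂ, IsSemiAnalyticVector φ ∧ (φ : LineGerm) = x :=
  Submodule.mem_map

/-- **`V_s^{ω*,∞}` in the germ model**: the germs with a smooth semi-analytic representative form
a subrepresentation of `principalSeriesLineModel s` (stability: `IsSmoothSemiAnalyticVector.lineSlash`).
[cite: BruggemanLewisZagier2015, §9.3 p. 51] -/
def smoothSemiAnalyticSubrep : Subrepresentation (principalSeriesLineModel s) where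
  toSubmodule := (smoothSemiAnalyticLineVectors s).map lineGermMk
  apply_mem_toSubmodule g := by
    rintro _ ⟨φ, hφ, rfl⟩
    obtain ⟨φ', hφ', he⟩ := IsSmoothSemiAnalyticVector.lineSlash (s := s) hφ g.unop
    exact ⟨φ', hφ', Filter.Germ.coe_eq.2 he⟩

/-- Membership in the germ model of `V_s^{ω*,∞}`. [cite: BruggemanLewisZagier2015, §9.3 p. 51] -/
theorem mem_smoothSemiAnalyticSubrep {x : LineGerm} :
    x ∈ (smoothSemiAnalyticSubrep s).toSubmodule ↔
      ∃ φ : ℝ → ℂ, IsSmoothSemiAnalyticVector s φ ∧ (φ : LineGerm) = x :=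
  Submodule.mem_map

/-- `V_s^{ω*,∞} ⊂ V_s^{ω*}` in the germ model. [cite: BruggemanLewisZagier2015, §9.3 p. 51] -/
theorem smoothSemiAnalyticSubrep_le :
    (smoothSemiAnalyticSubrep s).toSubmodule ≤ (semiAnalyticSubrep s).toSubmodule := by
  rintro _ ⟨φ, hφ, rfl⟩
  exact ⟨φ, hφ.1, rfl⟩

/-- **`V_s^{ω*}` as a representation of `Γᵐᵒᵖ`** along `ι : G →* GL₂(ℝ)`;
`groupCohomology.H1 (Rep.of (semiAnalyticLineModelOf ι s Γ))` is `H¹(Γ; V_s^{ω*})` of BLZ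
(the group in which, e.g., the period classes of `Γ`-invariant eigenfunctions are non-trivial,
§13.1). [cite: BruggemanLewisZagier2015, (5.4) p. 29] -/
abbrev semiAnalyticLineModelOf {G : Type*} [Group G] (ι : G →* GL (Fin 2) ℝ) (s : ℂ)
    (Γ : Subgroup G) : Representation ℂ (↥Γ)ᵐᵒᵖ ↥(semiAnalyticSubrep s).toSubmodule :=
  (semiAnalyticSubrep s).toRepresentation.comp (MonoidHom.op (ι.comp Γ.subtype))

/-- **`V_s^{ω*,∞}` as a representation of `Γᵐᵒᵖ`** along `ι`; its Mathlib `H1` is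
`H¹(Γ; V_s^{ω*,∞})`, the group containing the mixed parabolic cohomology of Theorem B.
[cite: BruggemanLewisZagier2015, Theorem B p. 6] -/
abbrev smoothSemiAnalyticLineModelOf {G : Type*} [Group G] (ι : G →* GL (Fin 2) ℝ) (s : ℂ)
    (Γ : Subgroup G) : Representation ℂ (↥Γ)ᵐᵒᵖ ↥(smoothSemiAnalyticSubrep s).toSubmodule :=
  (smoothSemiAnalyticSubrep s).toRepresentation.comp (MonoidHom.op (ι.comp Γ.subtype))

end Subrep

end Literature.NumberTheory.Automorphic
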